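import Mathlib
import Summits.MatrixMultiplication.MatrixMultiplication.Theorems.GradedDesignFamily.Negative.SubfieldCellCeilingExplicit
import Literature.NumberTheory.GaloisRepresentations.SL2WreathResidualImage

/-!
# The subfield cell `GL₂(𝔽₉) ⊃ SL₂(𝔽₃)` never beats the level-one sum of cubes
# (crux `LevelGradedCohnUmans.GradedDesignFamily`, stmt-MatrixMultiplication-7610; negative side,
# line `quadratic-extension-level-one-cell`, finite cell `q = 3` of stub S3 `stub_subfieldCell`)

HONEST FRAMING (B2b-5 certificates batch).  This is a DECIDED FINITE CELL, not summit progress: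
a theorem about every level-one separated triple `(φ(SL₂ k), Y, Z)` in `GL₂(K)` with `|k| = 3`,
`|K| = 9`.  It says the `(Q, σ) = (9, 1)` subfield cell is EMPTY at exponent three: its volume
`|SL₂(𝔽₃)|·|Y|·|Z| = 24·|Y|·|Z|` never exceeds the level-one sum of cubes
`B₃(9) = 1 + 9³ + (9 − 2)(9 + 1)³ = 7730` (the budget of
`LevelOneGL2Designs/Negative/Milestone`, `LieRankDesigns…stub_levelOneBudget`), indeed
`24·|Y|·|Z| ≤ 7350`.

PROOF.  The explicit ceiling `subfieldCell_ceiling_explicit` gives `|Y| + |Z| ≤ 3³ + 2·3 + 2 = 35`,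
hence `4|Y||Z| ≤ (|Y| + |Z|)² ≤ 1225` and `24|Y||Z| ≤ 7350 < 7730`; and
`|SL₂(𝔽₃)| = 3·(3² − 1) = 24` (`natCard_specialLinearGroup_fin_two`).

(The cells `q = 4, 5` are also empty at exponent three, but only through the `H`-equivariant
count `EquivariantCount.equivariantCount_le` with the exact isotypic multiplicities
`m_σ = 152` (`σ` the 3-dimensional characters of `SL₂(𝔽₄) ≅ A₅`, giving `|Y| + |Z| ≤ 51`) and
`m_σ = 414` (`σ` a 4-dimensional cuspidal character of `SL₂(𝔽₅)`, giving `|Y| + |Z| ≤ 104`);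
those multiplicities are a character computation recorded in the cell dossier `SUBFIELD.md`,
not formalised here.)

Sorry-free; axioms `propext`, `Classical.choice`, `Quot.sound`.
-/

set_option linter.dupNamespace false

open scoped BigOperators

namespace Summit.MatrixMultiplication.MatrixMultiplication.Theorems.GradedDesignFamily.Negative

/-- **The `q = 3` subfield cell is empty at exponent three.**  For fields `k ⊂ K` with `|k| = 3`,
`|K| = |k|²`, an injective hom `φ : SL₂(k) →* GL₂(K)` and nonempty `Y, Z ⊆ GL₂(K)` level-one
separated against `φ(SL₂ k)` (S3's clause verbatim), the design volume satisfies
`|SL₂(k)|·|Y|·|Z| ≤ 7350 < 7730 = 1 + |K|³ + (|K| − 2)(|K| + 1)³` (the level-one sum of cubes). -/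
theorem subfieldCell_nine_volume_le {k K : Type} [Field k] [Fintype k] [DecidableEq k] [Field K]
    [Fintype K] [DecidableEq K] (hk : Fintype.card k = 3)
    (φ : Matrix.SpecialLinearGroup (Fin 2) k →* Matrix.GeneralLinearGroup (Fin 2) K)
    (hφ : Function.Injective φ) (hK : Fintype.card K = Fintype.card k ^ 2)
    (Y Z : Finset (Matrix.GeneralLinearGroup (Fin 2) K)) (hY : Y.Nonempty) (hZ : Z.Nonempty)
    (hsep : ∀ z₀ ∈ Z, ∃ cf : (Fin 2 → K) → (Fin 2 → K) → ℂ,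
      ∀ a : Matrix.SpecialLinearGroup (Fin 2) k, ∀ y ∈ Y, ∀ y' ∈ Y, ∀ z ∈ Z,
        (∑ u : Fin 2 → K, cf u (((φ a * y * y'⁻¹ * z : Matrix.GeneralLinearGroup (Fin 2) K) :
            Matrix (Fin 2) (Fin 2) K).mulVec u)) =
          if a = 1 ∧ y = y' ∧ z = z₀ then 1 else 0) :
    Nat.card (Matrix.SpecialLinearGroup (Fin 2) k) * Y.card * Z.card ≤ 7350 := by
  have h := subfieldCell_ceiling_explicit φ hφ hK Y Z hY hZ hsep
  rw [hk] at h
  -- `|Y| + |Z| ≤ 35`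
  have hab : Y.card + Z.card ≤ 35 := by simpa using h
  have hcard : Nat.card (Matrix.SpecialLinearGroup (Fin 2) k) = 24 := by
    rw [Literature.NumberTheory.GaloisRepresentations.SL2Wreath.natCard_specialLinearGroup_fin_two,
      hk]; norm_num
  rw [hcard]
  have hprod : 4 * (Y.card * Z.card) ≤ (Y.card + Z.card) * (Y.card + Z.card) := by
    nlinarith [Nat.zero_le (Y.card), Nat.zero_le (Z.card), sq_nonneg ((Y.card : ℤ) - Z.card)]
  have h35 : (Y.card + Z.card) * (Y.card + Z.card) ≤ 35 * 35 := Nat.mul_le_mul hab hab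
  have : Y.card * Z.card ≤ 306 := by omega
  calc 24 * Y.card * Z.card = 24 * (Y.card * Z.card) := by ring
    _ ≤ 24 * 306 := by exact Nat.mul_le_mul_left _ this
    _ ≤ 7350 := by norm_num

/-- The same, against the level-one sum of cubes `B₃(|K|) = 1 + |K|³ + (|K| − 2)(|K| + 1)³`
(`= 7730` at `|K| = 9`): the `q = 3` subfield cell does not beat cubes. -/
theorem subfieldCell_nine_le_sumCubes {k K : Type} [Field k] [Fintype k] [DecidableEq k] [Field K]
    [Fintype K] [DecidableEq K] (hk : Fintype.card k = 3)
    (φ : Matrix.SpecialLinearGroup (Fin 2) k →* Matrix.GeneralLinearGroup (Fin 2) K)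
    (hφ : Function.Injective φ) (hK : Fintype.card K = Fintype.card k ^ 2)
    (Y Z : Finset (Matrix.GeneralLinearGroup (Fin 2) K)) (hY : Y.Nonempty) (hZ : Z.Nonempty)
    (hsep : ∀ z₀ ∈ Z, ∃ cf : (Fin 2 → K) → (Fin 2 → K) → ℂ,
      ∀ a : Matrix.SpecialLinearGroup (Fin 2) k, ∀ y ∈ Y, ∀ y' ∈ Y, ∀ z ∈ Z,
        (∑ u : Fin 2 → K, cf u (((φ a * y * y'⁻¹ * z : Matrix.GeneralLinearGroup (Fin 2) K) :
            Matrix (Fin 2) (Fin 2) K).mulVec u)) =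
          if a = 1 ∧ y = y' ∧ z = z₀ then 1 else 0) :
    Nat.card (Matrix.SpecialLinearGroup (Fin 2) k) * Y.card * Z.card <
      1 + Fintype.card K ^ 3 + (Fintype.card K - 2) * (Fintype.card K + 1) ^ 3 := by
  have h := subfieldCell_nine_volume_le hk φ hφ hK Y Z hY hZ hsep
  have hcard : Nat.card (Matrix.SpecialLinearGroup (Fin 2) k) = 24 := by
    rw [Literature.NumberTheory.GaloisRepresentations.SL2Wreath.natCard_specialLinearGroup_fin_two,
      hk]; norm_num
  rw [hcard] at h ⊢
  rw [hK, hk]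
  norm_num
  omega

end Summit.MatrixMultiplication.MatrixMultiplication.Theorems.GradedDesignFamily.Negative
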